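import Summits.CriticalPhenomena.PercolationContinuityZ3.Theorems.PercAnnulusCrossingIICRecurrenceZeroOne
import HarnessLib

/-!
# A zero-one law for the trace of Kesten's IIC on an arbitrary set: `ν(|C(0) ∩ S| = ∞) ∈ {0,1}` (lane RSW3, p1 gen 14)

builds on p205010 (kernel theorem, internal audit signed; external expert review pending) — used through `θ(p_c) = 0`
(`CSH.percolationContinuity_allDimensions`) in the `criticalProbI` statement; the `ℤ²` statement is unconditional.

Seat `prim-rsw3-p1` (gen 14); memo `run/shared/lean/prim/rsw3/P1-QM.md` §27.  Helper file for the crux `stmt-CriticalPhenomena-4575`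
chain; no definitions, no sorries.

For ANY set of sites `S ⊆ ℤ^d` the event `A_S = {C(0) ∩ S is unbounded} = {∀ k, C(0) meets S ∖ Λ(k)}` (= `{|C(0) ∩ S| = ∞}`, boxes being
finite) is the recurrence event of gen 14's zero-one law (`…IICRecurrenceZeroOne`) for the receding sequence `S_k = S ∖ Λ(k)`, the events
`{C(0) meets S ∖ Λ(k)}` being decreasing in `k`.  Hence, for every IIC measure `ν` (`θ(p) = 0`, (A2)□ at aspect `(s,L)`, `2 ≤ s`):

* **`iicMeasure_real_unbounded_trace_eq_zero_or_one`** — `ν(A_S) ∈ {0,1}` for EVERY `S ⊆ ℤ^d` (a Hewitt–Savage-type law for the trace of the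
  IIC, which is neither exchangeable nor shift invariant);
* `iicMeasure_tendsto_real_exists_openConn_sdiff_box` — `ν(C(0) meets S ∖ Λ(k)) ↓ ν(A_S)` as `k → ∞`;
* **`iicMeasure_real_unbounded_trace_eq_one_iff`** — the DICHOTOMY: `ν(A_S) = 1` iff `inf_k ν(C(0) meets S ∖ Λ(k)) > 0`, and otherwise
  `ν(C(0) meets S ∖ Λ(k)) → 0` and `ν(A_S) = 0`: the IIC meets a given set either almost surely infinitely often or almost surely finitely
  often;
* **`…_criticalProbI`**, **`…_Z2`**.

References: H.-O. Georgii, *Gibbs Measures and Phase Transitions* (2011), Prop. 7.9; H. Kesten, PTRF 73 (1986) Thm. (3); D. Basu,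
A. Sapozhnikov, ECP 22 (2017) no. 26, Thm. 1.1.
-/

noncomputable section

namespace Summit.CriticalPhenomena.PercolationContinuityZ3.Theorems.Crossing

open MeasureTheory Filter Topology Literature.Probability.Percolation Literature.Probability.LatticeModels
open Literature.Probability.Percolation.DCT16 Literature.Probability.Percolation.DKT20
open Summit.CriticalPhenomena.PercolationContinuityZ3.Theorems.SurfaceTension
open scoped Literature.Probability.Percolation ENNReal symmDiff

variable {d : ℕ}

/-- The sets `S ∖ Λ(k)` recede: `S ∖ Λ(k)` is disjoint from `Λ(r)` for `k ≥ r`. [folklore] -/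
theorem eventually_disjoint_sdiff_box (S : Set (Site d)) (r : ℕ) :
    ∀ᶠ k in atTop, Disjoint (S \ ↑(box d k)) ↑(box d r) :=
  Filter.eventually_atTop.2 ⟨r, fun _ hk => Set.disjoint_left.2 fun _ hv hvr => hv.2 (Finset.mem_coe.2 (box_mono d hk (Finset.mem_coe.1 hvr)))⟩

/-- `{∀ k, C(0) meets S ∖ Λ(k)} = {C(0) meets S ∖ Λ(k) for infinitely many k}` (the events decrease in `k`). [folklore] -/
theorem setOf_forall_exists_openConn_sdiff_box_eq (S : Set (Site d)) :
    {ω : BondConfig (Site d) | ∀ k : ℕ, ∃ v ∈ S \ ↑(box d k), ω ∈ (openConn (0 : Site d) v : Set (BondConfig (Site d)))} =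
      {ω | ∃ᶠ k in atTop, ∃ v ∈ S \ ↑(box d k), ω ∈ (openConn (0 : Site d) v : Set (BondConfig (Site d)))} := by
  ext ω
  simp only [Set.mem_setOf_eq, Filter.frequently_atTop]
  constructor
  · exact fun h M => ⟨M, le_rfl, h M⟩
  · intro h k
    obtain ⟨k', hk', v, hv, h0v⟩ := h k
    exact ⟨v, ⟨hv.1, fun hvk => hv.2 (Finset.mem_coe.2 (box_mono d hk' (Finset.mem_coe.1 hvk)))⟩, h0v⟩

/-- **ZERO-ONE LAW FOR THE TRACE OF KESTEN'S IIC ON AN ARBITRARY SET** (`θ(p) = 0`, (A2)□ at aspect `(s,L)`, `2 ≤ s`, `0 < p`, `d ≥ 1`; `ν` any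
IIC probability measure): for EVERY `S ⊆ ℤ^d`, `ν(C(0) meets S outside every box) ∈ {0,1}` — i.e. `ν(|C(0) ∩ S| = ∞)` is `0` or `1`.
[cite: Georgii2011, Prop. 7.9] [cite: Kesten1986, Thm. (3)] [cite: BasuSapozhnikov2017ECP, Thm. 1.1] -/
theorem iicMeasure_real_unbounded_trace_eq_zero_or_one (hd : 1 ≤ d) (p : unitInterval) (hp : 0 < (p : ℝ))
    (hθ : theta (zdGraph d) 0 p = 0) {s L : ℕ} (hs : 2 ≤ s) {ϰ : ℝ} (hϰ : 0 < ϰ) (hA2 : SetToSetQuasiMultAspectAt d p s L ϰ)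
    {ν : Measure (BondConfig (Site d))} [IsProbabilityMeasure ν]
    (hν : ∀ (F : Finset (Sym2 (Site d))) (E : Set (BondConfig (Site d))), MeasurableSet E → DeterminedBy E ↑F →
      Tendsto (fun n : ℕ => (bondPercolation (zdGraph d) p).real (E ∩ siteToBoundary d n) / oneArmProb d p n)
        atTop (𝓝 (ν.real E)))
    (S : Set (Site d)) :
    ν.real {ω : BondConfig (Site d) | ∀ k : ℕ, ∃ v ∈ S \ ↑(box d k), ω ∈ (openConn (0 : Site d) v : Set (BondConfig (Site d)))} = 0 ∨
      ν.real {ω : BondConfig (Site d) | ∀ k : ℕ, ∃ v ∈ S \ ↑(box d k), ω ∈ (openConn (0 : Site d) v : Set (BondConfig (Site d)))} = 1 := by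
  rw [setOf_forall_exists_openConn_sdiff_box_eq]
  exact iicMeasure_real_frequently_exists_openConn_eq_zero_or_one hd p hp hθ hs hϰ hA2 hν (fun k => S \ ↑(box d k))
    (eventually_disjoint_sdiff_box S)

/-- **`ν(C(0) meets S ∖ Λ(k)) ↓ ν(C(0) meets S outside every box)`** as `k → ∞` (decreasing events; any finite measure). [folklore] -/
theorem iicMeasure_tendsto_real_exists_openConn_sdiff_box (ν : Measure (BondConfig (Site d))) [IsFiniteMeasure ν] (S : Set (Site d)) :
    Tendsto (fun k : ℕ => ν.real {ω : BondConfig (Site d) | ∃ v ∈ S \ ↑(box d k), ω ∈ (openConn (0 : Site d) v : Set (BondConfig (Site d)))})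
      atTop (𝓝 (ν.real {ω : BondConfig (Site d) | ∀ k : ℕ, ∃ v ∈ S \ ↑(box d k), ω ∈ (openConn (0 : Site d) v : Set (BondConfig (Site d)))})) := by
  set E : ℕ → Set (BondConfig (Site d)) := fun k =>
    {ω | ∃ v ∈ S \ ↑(box d k), ω ∈ (openConn (0 : Site d) v : Set (BondConfig (Site d)))} with hE
  have hanti : Antitone E := by
    intro k k' hkk' ω hω
    obtain ⟨v, hv, h0v⟩ := hω
    exact ⟨v, ⟨hv.1, fun hvk => hv.2 (Finset.mem_coe.2 (box_mono d hkk' (Finset.mem_coe.1 hvk)))⟩, h0v⟩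
  have hmeas : ∀ k, NullMeasurableSet (E k) ν := fun k => (measurableSet_exists_openConn _).nullMeasurableSet
  have hlim := tendsto_measure_iInter_atTop hmeas hanti ⟨0, measure_ne_top ν _⟩
  have hI : (⋂ k, E k) = {ω : BondConfig (Site d) | ∀ k : ℕ, ∃ v ∈ S \ ↑(box d k), ω ∈ (openConn (0 : Site d) v : Set (BondConfig (Site d)))} := by
    ext ω; simp only [hE, Set.mem_iInter, Set.mem_setOf_eq]
  rw [hI] at hlim
  exact (ENNReal.tendsto_toReal (measure_ne_top ν _)).comp hlim

/-- **THE DICHOTOMY FOR THE TRACE OF THE IIC ON A SET** (hypotheses of `iicMeasure_real_unbounded_trace_eq_zero_or_one`): for every `S ⊆ ℤ^d`,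
`ν(C(0) meets S outside every box) = 1` iff `ν(C(0) meets S ∖ Λ(k)) ≥ c > 0` for all `k`; otherwise `ν(C(0) meets S ∖ Λ(k)) → 0` and the IIC
a.s. meets `S` inside some box only. [cite: Georgii2011, Prop. 7.9] [cite: Kesten1986, Thm. (3)] [cite: BasuSapozhnikov2017ECP, Thm. 1.1] -/
theorem iicMeasure_real_unbounded_trace_eq_one_iff (hd : 1 ≤ d) (p : unitInterval) (hp : 0 < (p : ℝ))
    (hθ : theta (zdGraph d) 0 p = 0) {s L : ℕ} (hs : 2 ≤ s) {ϰ : ℝ} (hϰ : 0 < ϰ) (hA2 : SetToSetQuasiMultAspectAt d p s L ϰ)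
    {ν : Measure (BondConfig (Site d))} [IsProbabilityMeasure ν]
    (hν : ∀ (F : Finset (Sym2 (Site d))) (E : Set (BondConfig (Site d))), MeasurableSet E → DeterminedBy E ↑F →
      Tendsto (fun n : ℕ => (bondPercolation (zdGraph d) p).real (E ∩ siteToBoundary d n) / oneArmProb d p n)
        atTop (𝓝 (ν.real E)))
    (S : Set (Site d)) :
    (ν.real {ω : BondConfig (Site d) | ∀ k : ℕ, ∃ v ∈ S \ ↑(box d k), ω ∈ (openConn (0 : Site d) v : Set (BondConfig (Site d)))} = 1 ↔
      ∃ c : ℝ, 0 < c ∧ ∀ k : ℕ,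
        c ≤ ν.real {ω : BondConfig (Site d) | ∃ v ∈ S \ ↑(box d k), ω ∈ (openConn (0 : Site d) v : Set (BondConfig (Site d)))}) ∧
    (ν.real {ω : BondConfig (Site d) | ∀ k : ℕ, ∃ v ∈ S \ ↑(box d k), ω ∈ (openConn (0 : Site d) v : Set (BondConfig (Site d)))} = 0 ↔
      Tendsto (fun k : ℕ => ν.real {ω : BondConfig (Site d) | ∃ v ∈ S \ ↑(box d k), ω ∈ (openConn (0 : Site d) v : Set (BondConfig (Site d)))})
        atTop (𝓝 0)) := by
  have h01 := iicMeasure_real_unbounded_trace_eq_zero_or_one hd p hp hθ hs hϰ hA2 hν S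
  have hlim := iicMeasure_tendsto_real_exists_openConn_sdiff_box ν S
  set A : Set (BondConfig (Site d)) :=
    {ω : BondConfig (Site d) | ∀ k : ℕ, ∃ v ∈ S \ ↑(box d k), ω ∈ (openConn (0 : Site d) v : Set (BondConfig (Site d)))} with hA
  have hmono : ∀ k, ν.real A ≤
      ν.real {ω : BondConfig (Site d) | ∃ v ∈ S \ ↑(box d k), ω ∈ (openConn (0 : Site d) v : Set (BondConfig (Site d)))} :=
    fun k => measureReal_mono fun ω hω => hω k
  constructor
  · constructor
    · intro h1
      exact ⟨1, one_pos, fun k => h1 ▸ hmono k⟩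
    · rintro ⟨c, hc, hck⟩
      have hAc : c ≤ ν.real A := ge_of_tendsto' hlim hck
      rcases h01 with h0 | h1
      · exact absurd h0 (ne_of_gt (lt_of_lt_of_le hc hAc))
      · exact h1
  · constructor
    · intro h0
      rw [h0] at hlim
      exact hlim
    · intro h
      exact tendsto_nhds_unique hlim h

/-- **Zero-one law and dichotomy for the trace of the IIC at `p_c(ℤ^d)`** (`d ≥ 2`, (A2)□ at aspect `(s,L)`, `2 ≤ s`; every IIC probability measure
`ν`; every `S ⊆ ℤ^d`). [cite: BasuSapozhnikov2017ECP, Thm. 1.1] [cite: Kesten1986, Thm. (3)] [cite: Georgii2011, Prop. 7.9] -/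
theorem iicMeasure_trace_zero_one_criticalProbI (hd : 2 ≤ d) {s L : ℕ} (hs : 2 ≤ s) {ϰ : ℝ} (hϰ : 0 < ϰ)
    (hA2 : SetToSetQuasiMultAspectAt d (criticalProbI d) s L ϰ)
    {ν : Measure (BondConfig (Site d))} [IsProbabilityMeasure ν]
    (hν : ∀ (F : Finset (Sym2 (Site d))) (E : Set (BondConfig (Site d))), MeasurableSet E → DeterminedBy E ↑F →
      Tendsto (fun n : ℕ => (bondPercolation (zdGraph d) (criticalProbI d)).real (E ∩ siteToBoundary d n) /
        oneArmProb d (criticalProbI d) n) atTop (𝓝 (ν.real E)))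
    (S : Set (Site d)) :
    (ν.real {ω : BondConfig (Site d) | ∀ k : ℕ, ∃ v ∈ S \ ↑(box d k), ω ∈ (openConn (0 : Site d) v : Set (BondConfig (Site d)))} = 0 ∨
      ν.real {ω : BondConfig (Site d) | ∀ k : ℕ, ∃ v ∈ S \ ↑(box d k), ω ∈ (openConn (0 : Site d) v : Set (BondConfig (Site d)))} = 1) ∧
    (ν.real {ω : BondConfig (Site d) | ∀ k : ℕ, ∃ v ∈ S \ ↑(box d k), ω ∈ (openConn (0 : Site d) v : Set (BondConfig (Site d)))} = 1 ↔
      ∃ c : ℝ, 0 < c ∧ ∀ k : ℕ,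
        c ≤ ν.real {ω : BondConfig (Site d) | ∃ v ∈ S \ ↑(box d k), ω ∈ (openConn (0 : Site d) v : Set (BondConfig (Site d)))}) := by
  have hd1 : 1 ≤ d := by omega
  have hpc : 0 < ((criticalProbI d : unitInterval) : ℝ) := by rw [coe_criticalProbI]; exact criticalProb_zd_pos d hd1
  have hθ : theta (zdGraph d) 0 (criticalProbI d) = 0 := CSH.percolationContinuity_allDimensions d hd
  exact ⟨iicMeasure_real_unbounded_trace_eq_zero_or_one hd1 (criticalProbI d) hpc hθ hs hϰ hA2 hν S,
    (iicMeasure_real_unbounded_trace_eq_one_iff hd1 (criticalProbI d) hpc hθ hs hϰ hA2 hν S).1⟩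

/-- **Zero-one law and dichotomy for the trace of Kesten's planar IIC, unconditionally** (every probability measure with the IIC limit
property at `p_c(ℤ²)`; every `S ⊆ ℤ²`). [cite: Kesten1986, Thm. (3)] [cite: Georgii2011, Prop. 7.9] -/
theorem iicMeasure_trace_zero_one_Z2 {ν : Measure (BondConfig (Site 2))} [IsProbabilityMeasure ν]
    (hν : ∀ (F : Finset (Sym2 (Site 2))) (E : Set (BondConfig (Site 2))), MeasurableSet E → DeterminedBy E ↑F →
      Tendsto (fun n : ℕ => (bondPercolation (zdGraph 2) (criticalProbI 2)).real (E ∩ siteToBoundary 2 n) /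
        oneArmProb 2 (criticalProbI 2) n) atTop (𝓝 (ν.real E)))
    (S : Set (Site 2)) :
    (ν.real {ω : BondConfig (Site 2) | ∀ k : ℕ, ∃ v ∈ S \ ↑(box 2 k), ω ∈ (openConn (0 : Site 2) v : Set (BondConfig (Site 2)))} = 0 ∨
      ν.real {ω : BondConfig (Site 2) | ∀ k : ℕ, ∃ v ∈ S \ ↑(box 2 k), ω ∈ (openConn (0 : Site 2) v : Set (BondConfig (Site 2)))} = 1) ∧
    (ν.real {ω : BondConfig (Site 2) | ∀ k : ℕ, ∃ v ∈ S \ ↑(box 2 k), ω ∈ (openConn (0 : Site 2) v : Set (BondConfig (Site 2)))} = 1 ↔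
      ∃ c : ℝ, 0 < c ∧ ∀ k : ℕ,
        c ≤ ν.real {ω : BondConfig (Site 2) | ∃ v ∈ S \ ↑(box 2 k), ω ∈ (openConn (0 : Site 2) v : Set (BondConfig (Site 2)))}) := by
  obtain ⟨ϰ, hϰ, hA2⟩ := exists_setToSetQuasiMultAspectAt_two_of_criticalProbI_le
  exact iicMeasure_trace_zero_one_criticalProbI (d := 2) le_rfl (by norm_num) hϰ (hA2 _ le_rfl) hν S

end Summit.CriticalPhenomena.PercolationContinuityZ3.Theorems.Crossing

end
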